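import Mathlib
import Summits.ValiantsHypothesis.ValiantsHypothesis.Theorems.MonotoneRestorationOrbitRestorationQPHomogTools
import HarnessLib

/-!
# Subalgebras generated by linear forms: projection substitutions, closedness, essential variables (ORBIT currency)

Route MonotoneRestoration, crux `OrbitRestorationQP` (stmt-ValiantsHypothesis-18293), line `depth-three-rung`, registered stub
`stub_sigmaPiSigmaKValue` (A_k).  Namespace `Summit.ValiantsHypothesis.ValiantsHypothesis.Theorems.LinearSubalgebra`.  Route-independent.

Layer L4 (a) of the formalisation plan of `Cruxes/OrbitRestorationQP/Lines/depth-three-rung-stubA-bounded-fanin.md` (§2 (d), §8 L4: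
"FACTOR CLOSEDNESS", "ESSENTIAL SPACE").  For a subspace `Λ` of polynomials of total degree `≤ 1` containing the constants, the
subalgebra `K[Λ] = adjoin K Λ` is studied through the SUBSTITUTION ENDOMORPHISM `subst P : X_v ↦ P (X_v)` of a linear projection
`P` onto `Λ` (no coordinates are needed): `subst P` acts as `P` on degree-`≤ 1` polynomials, fixes `K[Λ]` pointwise, and maps
everything into `K[Λ]`.  Consequences:

* `mem_adjoin_inf` — `K[Λ₁] ∩ K[Λ₂] = K[Λ₁ ∩ Λ₂]` (project onto `Λ₁` along a complement containing a complement of `Λ₁ ∩ Λ₂`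
  in `Λ₂`);
* `mem_of_dvd_of_totalDegree_le_one` — a degree-`≤ 1` divisor of a nonzero element of `K[Λ]` lies in `Λ` (project it to `0`);
* `mem_adjoin_of_mul_mem` — `a ∈ K[Λ]`, `a ≠ 0`, `a * b ∈ K[Λ]` `⇒` `b ∈ K[Λ]` (cancel);
* `ess p` — the ESSENTIAL SPACE of `p`: the least admissible `Λ` (`exists_isLeast`, by the intersection lemma and finite dimension),
  with `mem_adjoin_ess`, `ess_le`, `ess_map` (equivariance under degree-preserving algebra automorphisms) and `ess_C_mul`.

Everything is proved. [folklore]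
-/

noncomputable section

open MvPolynomial

-- `Summit.ValiantsHypothesis.ValiantsHypothesis.…` is the tree's single-conjunct layout (Sub = Summit).
set_option linter.dupNamespace false

namespace Summit.ValiantsHypothesis.ValiantsHypothesis.Theorems

namespace LinearSubalgebra

variable {K : Type} [Field K] {V : Type} [Fintype V] [DecidableEq V]

/-- The space of polynomials of total degree `≤ 1` (affine forms). [folklore] -/
abbrev deg1 (K : Type) [Field K] (V : Type) : Submodule K (MvPolynomial V K) := restrictTotalDegree V K 1

omit [Fintype V] [DecidableEq V] in
/-- Membership in `deg1`. [folklore] -/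
theorem mem_deg1 {q : MvPolynomial V K} : q ∈ deg1 K V ↔ q.totalDegree ≤ 1 := mem_restrictTotalDegree _ _ _

/-- An ADMISSIBLE space for `p`: a subspace of affine forms containing the constants whose generated subalgebra contains `p`.
[folklore] -/
def Admissible (p : MvPolynomial V K) (Λ : Submodule K (MvPolynomial V K)) : Prop :=
  Λ ≤ deg1 K V ∧ C 1 ∈ Λ ∧ p ∈ Algebra.adjoin K (Λ : Set (MvPolynomial V K))

/-! ### The substitution endomorphism of a linear map -/

/-- The substitution endomorphism `X_v ↦ P (X_v)` of a linear endomorphism `P` of the polynomial ring. [folklore] -/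
def subst (P : MvPolynomial V K →ₗ[K] MvPolynomial V K) : MvPolynomial V K →ₐ[K] MvPolynomial V K :=
  aeval fun v => P (X v)

/-- On polynomials of total degree `≤ 1`, `subst P` IS `P` (if `P` fixes the constants). [folklore] -/
theorem subst_eq_of_totalDegree_le_one (P : MvPolynomial V K →ₗ[K] MvPolynomial V K) (hP1 : P (C 1) = C 1)
    {q : MvPolynomial V K} (hq : q.totalDegree ≤ 1) : subst P q = P q := by
  conv_lhs => rw [HomogTools.eq_C_add_sum_of_totalDegree_le_one hq]
  conv_rhs => rw [HomogTools.eq_C_add_sum_of_totalDegree_le_one hq]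
  simp only [subst, map_add, map_sum, map_mul, aeval_C, aeval_X, algebraMap_eq]
  congr 1
  · rw [show C (coeff 0 q) = coeff 0 q • C (1 : K) by rw [smul_eq_C_mul, C_1, mul_one], map_smul, hP1]
  · exact Finset.sum_congr rfl fun v _ => by rw [← smul_eq_C_mul, ← smul_eq_C_mul, map_smul]

omit [Fintype V] [DecidableEq V] in
/-- `subst P` maps everything into the subalgebra generated by the values `P (X_v)`. [folklore] -/
theorem subst_mem_adjoin (P : MvPolynomial V K →ₗ[K] MvPolynomial V K) (p : MvPolynomial V K) :
    subst P p ∈ Algebra.adjoin K (Set.range fun v => P (X v)) := by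
  rw [Algebra.adjoin_range_eq_range_aeval]
  exact ⟨p, rfl⟩

/-- `subst P` fixes `K[Λ]` pointwise when `P` fixes `Λ ∋ 1`, `Λ ≤ deg1`. [folklore] -/
theorem subst_eq_self (P : MvPolynomial V K →ₗ[K] MvPolynomial V K) {Λ : Submodule K (MvPolynomial V K)}
    (hΛ : Λ ≤ deg1 K V) (h1 : C 1 ∈ Λ) (hP : ∀ x ∈ Λ, P x = x) {p : MvPolynomial V K}
    (hp : p ∈ Algebra.adjoin K (Λ : Set (MvPolynomial V K))) : subst P p = p := by
  refine Algebra.adjoin_induction (hx := hp) (fun x hx => ?_) (fun r => ?_) (fun x y _ _ hx hy => ?_)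
    (fun x y _ _ hx hy => ?_)
  · rw [subst_eq_of_totalDegree_le_one P (hP _ h1) (mem_deg1.1 (hΛ hx)), hP x hx]
  · exact AlgHom.commutes _ r
  · rw [map_add, hx, hy]
  · rw [map_mul, hx, hy]

/-! ### The intersection lemma -/

/-- **`K[Λ₁] ∩ K[Λ₂] = K[Λ₁ ∩ Λ₂]`** for subspaces of affine forms containing the constants. [folklore] -/
theorem mem_adjoin_inf {Λ₁ Λ₂ : Submodule K (MvPolynomial V K)} (hΛ₁ : Λ₁ ≤ deg1 K V) (hΛ₂ : Λ₂ ≤ deg1 K V)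
    (h1 : C 1 ∈ Λ₁) {p : MvPolynomial V K}
    (hp1 : p ∈ Algebra.adjoin K (Λ₁ : Set (MvPolynomial V K))) (hp2 : p ∈ Algebra.adjoin K (Λ₂ : Set (MvPolynomial V K))) :
    p ∈ Algebra.adjoin K ((Λ₁ ⊓ Λ₂ : Submodule K (MvPolynomial V K)) : Set (MvPolynomial V K)) := by
  set U := Λ₁ ⊓ Λ₂ with hU
  -- a complement `C₂` of `U` inside `Λ₂`
  obtain ⟨C₂', hC₂'⟩ := Submodule.exists_isCompl (U.comap Λ₂.subtype)
  set C₂ : Submodule K (MvPolynomial V K) := C₂'.map Λ₂.subtype with hC₂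
  have hC₂le : C₂ ≤ Λ₂ := by
    rintro x ⟨y, -, rfl⟩; exact y.2
  have hUC₂ : Disjoint U C₂ := by
    rw [Submodule.disjoint_def]
    rintro x hxU ⟨y, hy, rfl⟩
    have hyU : y ∈ U.comap Λ₂.subtype := hxU
    have := (Submodule.disjoint_def.1 hC₂'.disjoint) y hyU hy
    rw [this]; rfl
  have hsup : ∀ x ∈ Λ₂, ∃ u ∈ U, ∃ c ∈ C₂, x = u + c := by
    intro x hx
    have htop : (⟨x, hx⟩ : Λ₂) ∈ (U.comap Λ₂.subtype) ⊔ C₂' := by rw [hC₂'.sup_eq_top]; trivial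
    obtain ⟨u, hu, c, hc, huc⟩ := Submodule.mem_sup.1 htop
    refine ⟨(u : MvPolynomial V K), hu, c, ⟨c, hc, rfl⟩, ?_⟩
    have := congrArg Subtype.val huc
    simpa using this.symm
  -- a complement `N` of `Λ₁` containing `C₂`
  have hdisj : Disjoint C₂ Λ₁ := by
    rw [Submodule.disjoint_def]
    intro x hxC hx1
    exact (Submodule.disjoint_def.1 hUC₂) x ⟨hx1, hC₂le hxC⟩ hxC
  obtain ⟨N, hC₂N, hN⟩ := hdisj.exists_isCompl
  -- the projection onto `Λ₁` along `N` and its substitution endomorphism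
  let P : MvPolynomial V K →ₗ[K] MvPolynomial V K := Λ₁.projection N hN.symm
  have hPΛ₁ : ∀ x ∈ Λ₁, P x = x := fun x hx => Submodule.projection_apply_of_mem_left hN.symm hx
  have hPN : ∀ x ∈ N, P x = 0 := fun x hx => Submodule.projection_apply_of_mem_right hN.symm hx
  have hfix : subst P p = p := subst_eq_self P hΛ₁ h1 hPΛ₁ hp1
  -- `subst P` maps `K[Λ₂]` into `K[U]`
  have himg : (Algebra.adjoin K (Λ₂ : Set (MvPolynomial V K))).map (subst P) ≤
      Algebra.adjoin K (U : Set (MvPolynomial V K)) := by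
    rw [AlgHom.map_adjoin]
    refine Algebra.adjoin_mono ?_
    rintro _ ⟨x, hx, rfl⟩
    obtain ⟨u, hu, c, hc, rfl⟩ := hsup x hx
    have hdeg : (u + c).totalDegree ≤ 1 := mem_deg1.1 (hΛ₂ hx)
    rw [subst_eq_of_totalDegree_le_one P (hPΛ₁ _ h1) hdeg, map_add, hPΛ₁ u hu.1, hPN c (hC₂N hc), add_zero]
    exact hu
  rw [← hfix]
  exact himg ⟨p, hp2, rfl⟩

/-! ### Closedness under linear divisors and under quotients -/

/-- **A divisor of total degree `≤ 1` of a nonzero element of `K[Λ]` lies in `Λ`** (otherwise project it to `0` along a complement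
containing it). [folklore] -/
theorem mem_of_dvd_of_totalDegree_le_one {Λ : Submodule K (MvPolynomial V K)} (hΛ : Λ ≤ deg1 K V) (h1 : C 1 ∈ Λ)
    {p ℓ : MvPolynomial V K} (hp : p ∈ Algebra.adjoin K (Λ : Set (MvPolynomial V K))) (hp0 : p ≠ 0)
    (hℓ : ℓ.totalDegree ≤ 1) (hdvd : ℓ ∣ p) : ℓ ∈ Λ := by
  by_contra hℓΛ
  -- `span {ℓ}` is disjoint from `Λ`
  have hdisj : Disjoint (K ∙ ℓ) Λ := by
    rw [Submodule.disjoint_def]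
    intro x hx hxΛ
    obtain ⟨a, rfl⟩ := Submodule.mem_span_singleton.1 hx
    by_contra hne
    have ha : a ≠ 0 := by rintro rfl; exact hne (zero_smul _ _)
    exact hℓΛ (by simpa [smul_smul, inv_mul_cancel₀ ha] using Λ.smul_mem a⁻¹ hxΛ)
  obtain ⟨N, hℓN, hN⟩ := hdisj.exists_isCompl
  let P : MvPolynomial V K →ₗ[K] MvPolynomial V K := Λ.projection N hN.symm
  have hPΛ : ∀ x ∈ Λ, P x = x := fun x hx => Submodule.projection_apply_of_mem_left hN.symm hx
  have hPℓ : P ℓ = 0 := Submodule.projection_apply_of_mem_right hN.symm (hℓN (Submodule.mem_span_singleton_self ℓ))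
  obtain ⟨r, rfl⟩ := hdvd
  have hfix := subst_eq_self P hΛ h1 hPΛ hp
  rw [map_mul, subst_eq_of_totalDegree_le_one P (hPΛ _ h1) hℓ, hPℓ, zero_mul] at hfix
  exact hp0 hfix.symm

/-- **Quotient closedness**: `a ∈ K[Λ]`, `a ≠ 0`, `a * b ∈ K[Λ]` imply `b ∈ K[Λ]`. [folklore] -/
theorem mem_adjoin_of_mul_mem {Λ : Submodule K (MvPolynomial V K)} (hΛ : Λ ≤ deg1 K V) (h1 : C 1 ∈ Λ)
    {a b : MvPolynomial V K} (ha : a ∈ Algebra.adjoin K (Λ : Set (MvPolynomial V K))) (ha0 : a ≠ 0)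
    (hab : a * b ∈ Algebra.adjoin K (Λ : Set (MvPolynomial V K))) : b ∈ Algebra.adjoin K (Λ : Set (MvPolynomial V K)) := by
  obtain ⟨N, hN⟩ := Submodule.exists_isCompl Λ
  let P : MvPolynomial V K →ₗ[K] MvPolynomial V K := Λ.projection N hN
  have hPΛ : ∀ x ∈ Λ, P x = x := fun x hx => Submodule.projection_apply_of_mem_left hN hx
  have h1' := subst_eq_self P hΛ h1 hPΛ hab
  rw [map_mul, subst_eq_self P hΛ h1 hPΛ ha] at h1'
  have hb : subst P b = b := mul_left_cancel₀ ha0 h1'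
  rw [← hb]
  have := subst_mem_adjoin P b
  refine Algebra.adjoin_mono ?_ this
  rintro _ ⟨v, rfl⟩
  exact (Submodule.projection_apply_mem hN (X v))

/-! ### The essential space -/

omit [Fintype V] [DecidableEq V] in
/-- The whole space of affine forms is admissible. [folklore] -/
theorem admissible_deg1 (p : MvPolynomial V K) : Admissible p (deg1 K V) := by
  refine ⟨le_rfl, mem_deg1.2 (by rw [totalDegree_C]; exact Nat.zero_le _), ?_⟩
  have : Algebra.adjoin K ((deg1 K V : Submodule K (MvPolynomial V K)) : Set (MvPolynomial V K)) = ⊤ := by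
    rw [eq_top_iff, ← MvPolynomial.adjoin_range_X, Algebra.adjoin_le_iff]
    rintro _ ⟨v, rfl⟩
    exact Algebra.subset_adjoin (mem_deg1.2 (by rw [totalDegree_X]))
  rw [this]; trivial

/-- Admissible spaces are closed under intersection. [folklore] -/
theorem admissible_inf {p : MvPolynomial V K} {Λ₁ Λ₂ : Submodule K (MvPolynomial V K)} (h₁ : Admissible p Λ₁)
    (h₂ : Admissible p Λ₂) : Admissible p (Λ₁ ⊓ Λ₂) :=
  ⟨inf_le_left.trans h₁.1, ⟨h₁.2.1, h₂.2.1⟩, mem_adjoin_inf h₁.1 h₂.1 h₁.2.1 h₁.2.2 h₂.2.2⟩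

/-- **There is a LEAST admissible space** (an admissible space of minimal dimension is least, by `admissible_inf`). [folklore] -/
theorem exists_isLeast (p : MvPolynomial V K) : ∃ Λ, IsLeast {Λ' | Admissible p Λ'} Λ := by
  classical
  -- admissible spaces are finite-dimensional, pick one of minimal dimension
  have hex : ∃ d, ∃ Λ, Admissible p Λ ∧ Module.finrank K Λ = d := ⟨_, _, admissible_deg1 p, rfl⟩
  obtain ⟨Λ, hΛ, hd⟩ := Nat.find_spec hex
  refine ⟨Λ, hΛ, fun Λ' hΛ' => ?_⟩
  have hinf := admissible_inf hΛ hΛ'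
  haveI : FiniteDimensional K Λ := Submodule.finiteDimensional_of_le hΛ.1
  have hle : Module.finrank K Λ ≤ Module.finrank K (Λ ⊓ Λ' : Submodule K (MvPolynomial V K)) := by
    rw [hd]
    exact Nat.find_min' hex ⟨_, hinf, rfl⟩
  have heq : Λ ⊓ Λ' = Λ := Submodule.eq_of_le_of_finrank_le inf_le_left hle
  rw [← heq]
  exact inf_le_right

/-- **The essential space of `p`**: the least subspace `Λ` of affine forms containing the constants with `p ∈ K[Λ]`. [folklore] -/
def ess (p : MvPolynomial V K) : Submodule K (MvPolynomial V K) := (exists_isLeast p).choose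

/-- `ess p` is the least admissible space. [folklore] -/
theorem isLeast_ess (p : MvPolynomial V K) : IsLeast {Λ' | Admissible p Λ'} (ess p) := (exists_isLeast p).choose_spec

/-- `ess p` is admissible: `p ∈ K[ess p]`, `C 1 ∈ ess p`, `ess p ≤ deg1`. [folklore] -/
theorem admissible_ess (p : MvPolynomial V K) : Admissible p (ess p) := (isLeast_ess p).1

/-- `p ∈ K[ess p]`. [folklore] -/
theorem mem_adjoin_ess (p : MvPolynomial V K) : p ∈ Algebra.adjoin K (ess p : Set (MvPolynomial V K)) :=
  (admissible_ess p).2.2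

/-- `ess p ≤ Λ` for every admissible `Λ`. [folklore] -/
theorem ess_le {p : MvPolynomial V K} {Λ : Submodule K (MvPolynomial V K)} (h : Admissible p Λ) : ess p ≤ Λ :=
  (isLeast_ess p).2 h

/-- A least admissible space is `ess p`. [folklore] -/
theorem ess_eq_of_isLeast {p : MvPolynomial V K} {Λ : Submodule K (MvPolynomial V K)} (h : IsLeast {Λ' | Admissible p Λ'} Λ) :
    ess p = Λ :=
  (isLeast_ess p).unique h

/-- `ess` is insensitive to nonzero constant factors. [folklore] -/
theorem ess_C_mul {p : MvPolynomial V K} {u : K} (hu : u ≠ 0) : ess (C u * p) = ess p := by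
  have hadm : ∀ Λ, Admissible (C u * p) Λ ↔ Admissible p Λ := by
    intro Λ
    simp only [Admissible]
    refine and_congr_right fun _ => and_congr_right fun _ => ⟨fun h => ?_, fun h => ?_⟩
    · have : p = C u⁻¹ * (C u * p) := by rw [← mul_assoc, ← map_mul, inv_mul_cancel₀ hu, C_1, one_mul]
      rw [this]
      exact Subalgebra.mul_mem _ (Subalgebra.algebraMap_mem _ _) h
    · exact Subalgebra.mul_mem _ (Subalgebra.algebraMap_mem _ _) h
  refine ess_eq_of_isLeast ⟨(hadm _).2 (admissible_ess p), fun Λ hΛ => ess_le ((hadm Λ).1 hΛ)⟩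

/-- **Equivariance of the essential space** under an algebra automorphism preserving the affine forms. [folklore] -/
theorem ess_map (φ : MvPolynomial V K ≃ₐ[K] MvPolynomial V K) (hφ : ∀ q : MvPolynomial V K, q.totalDegree ≤ 1 → (φ q).totalDegree ≤ 1)
    (hφ' : ∀ q : MvPolynomial V K, q.totalDegree ≤ 1 → (φ.symm q).totalDegree ≤ 1) (p : MvPolynomial V K) :
    ess (φ p) = (ess p).map φ.toLinearEquiv.toLinearMap := by
  -- admissible spaces correspond under `map φ`
  have hmap : ∀ (ψ : MvPolynomial V K ≃ₐ[K] MvPolynomial V K),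
      (∀ q : MvPolynomial V K, q.totalDegree ≤ 1 → (ψ q).totalDegree ≤ 1) →
      ∀ (r : MvPolynomial V K) Λ, Admissible r Λ → Admissible (ψ r) (Λ.map ψ.toLinearEquiv.toLinearMap) := by
    intro ψ hψ r Λ h
    refine ⟨?_, ⟨C 1, h.2.1, by simp⟩, ?_⟩
    · rintro _ ⟨x, hx, rfl⟩
      exact mem_deg1.2 (hψ x (mem_deg1.1 (h.1 hx)))
    · have : ψ r ∈ (Algebra.adjoin K (Λ : Set (MvPolynomial V K))).map (ψ : MvPolynomial V K →ₐ[K] MvPolynomial V K) :=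
        Subalgebra.mem_map.2 ⟨r, h.2.2, rfl⟩
      rw [AlgHom.map_adjoin] at this
      convert this using 2
      ext x; simp
  refine ess_eq_of_isLeast ⟨hmap φ hφ p _ (admissible_ess p), fun Λ hΛ => ?_⟩
  have h1 := hmap φ.symm hφ' (φ p) Λ hΛ
  rw [φ.symm_apply_apply] at h1
  have h2 := Submodule.map_mono (f := φ.toLinearEquiv.toLinearMap) (ess_le h1)
  refine le_trans h2 ?_
  rintro _ ⟨x, ⟨y, hy, rfl⟩, rfl⟩
  simpa using hy

/-- The essential space is finite-dimensional, of dimension at most that of any admissible space. [folklore] -/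
theorem finrank_ess_le {p : MvPolynomial V K} {Λ : Submodule K (MvPolynomial V K)} (h : Admissible p Λ)
    [FiniteDimensional K Λ] : Module.finrank K (ess p) ≤ Module.finrank K Λ :=
  Submodule.finrank_mono (ess_le h)

end LinearSubalgebra

end Summit.ValiantsHypothesis.ValiantsHypothesis.Theorems

end
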